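import Mathlib.Combinatorics.SetFamily.Compression.UV
import Mathlib.Combinatorics.SetFamily.Intersecting
import Mathlib.Combinatorics.Enumerative.DoubleCounting
import Mathlib.Algebra.Order.BigOperators.Group.Finset

/-!
# Katona's intersecting shadow theorem (Katona 1964), proved

Source: G. Katona, *Intersection theorems for systems of finite sets*, Acta Math. Acad. Sci. Hungar. **15** (1964)
329–337, Theorem 1 (the case of pairwise intersecting families and the shadow one level down): **if `𝒜` is a family of
`k`-element sets any two of which intersect, then its shadow `∂ 𝒜 = {A ∖ {x} : A ∈ 𝒜, x ∈ A}` has at least `#𝒜`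
members.**  (Katona's Theorem 1 is the general statement for `t`-intersecting families and the shadow `t` levels down,
with the factor `C(2k-t, g)/C(2k-t, k)`; only the case `t = 1`, `g = k - 1`, where the factor is `1`, is formalised
here.)

## Proof formalised (the standard shifting proof)

Induction on the size `n` of a ground set `s ⊇ ⋃ 𝒜`, for all `k` at once.
* If `n + 1 ≤ 2k`, the local LYM inequality `#𝒜 · k ≤ #∂𝒜 · (n + 1 - k)` (double counting the pairs `B ⊆ A`, `A ∈ 𝒜`,
  `B ∈ ∂𝒜`; proved here relative to the ground finset `s`, `KatonaShadow.card_mul_le_card_shadow_mul`) gives `#𝒜 ≤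
  #∂𝒜` at once.
* If `2k ≤ n`, fix `ℓ ∈ s` and replace `𝒜` by a family `ℬ` that is `({i},{ℓ})`-compressed for every `i ∈ s` (Mathlib's
  `UV.compression` with singletons = the `(i,ℓ)`-shift), of the same size, still `k`-uniform and intersecting
  (`KatonaShadow.intersecting_compression`), with no larger shadow (Mathlib's `UV.card_shadow_compression_le`); such a
  `ℬ` exists because every non-trivial shift strictly decreases the number of members containing `ℓ`
  (`KatonaShadow.exists_compressed`).  Split `ℬ` into `ℬ₀ = {B : ℓ ∉ B}` and `ℬ₁ = {B ∖ {ℓ} : ℓ ∈ B}` on the ground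
  set `s ∖ {ℓ}`.  The point: `ℬ₁` is again intersecting (`KatonaShadow.intersecting_image_erase_of_isCompressed`) — if
  `B ∩ B' = {ℓ}` then `#(B ∪ B') = 2k - 1 < n`, so some `i ∈ s` misses `B ∪ B'`, and the shift `B' - ℓ + i ∈ ℬ` is
  disjoint from `B`.  Since `∂ℬ ⊇ ∂ℬ₀ ⊔ {E + ℓ : E ∈ ∂ℬ₁}` (`KatonaShadow.card_shadow_split`), the induction
  hypothesis for `ℬ₀` (level `k`) and `ℬ₁` (level `k - 1`) gives `#𝒜 = #ℬ₀ + #ℬ₁ ≤ #∂ℬ₀ + #∂ℬ₁ ≤ #∂ℬ ≤ #∂𝒜`.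

## Contents

* `card_le_card_shadow_of_sized_of_intersecting` — Katona's theorem (`k`-uniform intersecting families, any type with
  decidable equality, no ground-set hypothesis).
* `card_le_card_shadow_of_intersecting` — the immediate non-uniform consequence: EVERY finite intersecting family
  satisfies `#𝒜 ≤ #∂𝒜` (sum the uniform statement over the levels; shadows of different levels are disjoint).

Mathlib has Kruskal–Katona (`Finset.kruskal_katona`), Erdős–Ko–Rado, LYM and the `UV`-compression API, but not this
theorem (searched `Katona`, `shadow.*ntersecting`, `card_le_card_shadow`). Not here: the `t`-intersecting /
deeper-shadow version, the cases of equality.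
-/

namespace Literature.Combinatorics.SetFamily

open Finset
open scoped FinsetFamily

variable {α : Type*} [DecidableEq α]

namespace KatonaShadow

/-! ### The `(i, ℓ)`-shift = `UV`-compression along the singletons `{i}`, `{ℓ}` -/

/-- The shift of a set containing `ℓ` and avoiding `i` replaces `ℓ` by `i`. [folklore] -/
private theorem compress_eq {i ℓ : α} {a : Finset α} (hℓ : ℓ ∈ a) (hi : i ∉ a) :
    UV.compress ({i} : Finset α) {ℓ} a = (a ∪ {i}) \ {ℓ} := by
  rw [UV.compress_of_disjoint_of_le (disjoint_singleton_left.2 hi) (singleton_subset_iff.2 hℓ),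
    sup_eq_union]

/-- A set not containing `ℓ`, or containing `i`, is not moved by the shift. [folklore] -/
private theorem compress_eq_self {i ℓ : α} {a : Finset α} (h : ¬ (ℓ ∈ a ∧ i ∉ a)) :
    UV.compress ({i} : Finset α) {ℓ} a = a := by
  unfold UV.compress
  rw [if_neg]
  rintro ⟨hd, hle⟩
  exact h ⟨singleton_subset_iff.1 hle, disjoint_singleton_left.1 hd⟩

/-- Membership in a shifted set. [folklore] -/
private theorem mem_compress_iff {i ℓ x : α} {a : Finset α} (hℓ : ℓ ∈ a) (hi : i ∉ a) :
    x ∈ UV.compress ({i} : Finset α) {ℓ} a ↔ (x ∈ a ∨ x = i) ∧ x ≠ ℓ := by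
  rw [compress_eq hℓ hi, mem_sdiff, mem_union, mem_singleton, mem_singleton]

/-- A shifted set lies inside the old set plus `i`. [folklore] -/
private theorem compress_subset_union (i ℓ : α) (a : Finset α) :
    UV.compress ({i} : Finset α) {ℓ} a ⊆ a ∪ {i} := by
  by_cases h : ℓ ∈ a ∧ i ∉ a
  · rw [compress_eq h.1 h.2]; exact sdiff_subset
  · rw [compress_eq_self h]; exact subset_union_left

/-- A set that is actually moved by the `(i,ℓ)`-shift no longer contains `ℓ`. [folklore] -/
private theorem not_mem_compress {i ℓ : α} {a : Finset α} (h : ℓ ∈ a ∧ i ∉ a) :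
    ℓ ∉ UV.compress ({i} : Finset α) {ℓ} a := by
  rw [mem_compress_iff h.1 h.2]
  exact fun hx => hx.2 rfl

/-- Every member of the shifted family is an old member, or the shift of an old member `b` that contains `ℓ`, avoids `i`,
and whose shift is new. [folklore] -/
private theorem mem_compression_cases {i ℓ : α} {𝒜 : Finset (Finset α)} {a : Finset α}
    (ha : a ∈ 𝓒 ({i} : Finset α) {ℓ} 𝒜) :
    a ∈ 𝒜 ∨ ∃ b ∈ 𝒜, (ℓ ∈ b ∧ i ∉ b) ∧ UV.compress ({i} : Finset α) {ℓ} b ∉ 𝒜 ∧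
      a = UV.compress ({i} : Finset α) {ℓ} b := by
  rw [UV.mem_compression] at ha
  rcases ha with ⟨ha, -⟩ | ⟨hna, b, hb, hba⟩
  · exact Or.inl ha
  · right
    refine ⟨b, hb, ?_, ?_, hba.symm⟩
    · by_contra h
      rw [compress_eq_self h] at hba
      exact hna (hba ▸ hb)
    · rwa [hba]

/-- An old member that survives in the shifted family has its shift in the old family. [folklore] -/
private theorem compress_mem_of_mem_of_mem_compression {i ℓ : α} {𝒜 : Finset (Finset α)} {a : Finset α}
    (ha : a ∈ 𝓒 ({i} : Finset α) {ℓ} 𝒜) (ha𝒜 : a ∈ 𝒜) :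
    UV.compress ({i} : Finset α) {ℓ} a ∈ 𝒜 := by
  rw [UV.mem_compression] at ha
  rcases ha with ⟨-, h⟩ | ⟨hna, -⟩
  · exact h
  · exact (hna ha𝒜).elim

/-- Shifting along `i ∈ s` keeps a family inside the ground set `s`. [folklore] -/
private theorem subset_of_mem_compression {i ℓ : α} {s : Finset α} (hi : i ∈ s) {𝒜 : Finset (Finset α)}
    (h𝒜 : ∀ a ∈ 𝒜, a ⊆ s) : ∀ a ∈ 𝓒 ({i} : Finset α) {ℓ} 𝒜, a ⊆ s := by
  intro a ha
  rcases mem_compression_cases ha with ha | ⟨b, hb, -, -, rfl⟩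
  · exact h𝒜 a ha
  · exact (compress_subset_union i ℓ b).trans (union_subset (h𝒜 b hb) (singleton_subset_iff.2 hi))

/-! ### Shifting preserves the intersecting property -/

/-- Key step: if `a` and its shift are both old members and `b` is an old member containing `ℓ` and avoiding `i`, then `a`
meets the shift of `b`. [folklore] -/
private theorem not_disjoint_compress {i ℓ : α} {𝒜 : Finset (Finset α)}
    (h𝒜 : (𝒜 : Set (Finset α)).Intersecting) {a b : Finset α} (ha : a ∈ 𝒜)
    (hca : UV.compress ({i} : Finset α) {ℓ} a ∈ 𝒜) (hb : b ∈ 𝒜) (hℓb : ℓ ∈ b) (hib : i ∉ b) :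
    ¬ Disjoint a (UV.compress ({i} : Finset α) {ℓ} b) := by
  intro hdis
  have hiℓ : i ≠ ℓ := fun h => hib (h ▸ hℓb)
  -- every common element of `a` and `b` is `ℓ`; there is one, so `ℓ ∈ a`
  have hcommon : ∀ x ∈ a, x ∈ b → x = ℓ := by
    intro x hxa hxb
    by_contra hne
    exact disjoint_left.1 hdis hxa ((mem_compress_iff hℓb hib).2 ⟨Or.inl hxb, hne⟩)
  have hℓa : ℓ ∈ a := by
    obtain ⟨x, hxa, hxb⟩ := not_disjoint_iff.1 (h𝒜 ha hb)
    exact hcommon x hxa hxb ▸ hxa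
  have hia : i ∉ a := fun hia =>
    disjoint_left.1 hdis hia ((mem_compress_iff hℓb hib).2 ⟨Or.inr rfl, hiℓ⟩)
  -- then the shift of `a` is disjoint from `b`: contradiction
  refine h𝒜 hca hb (disjoint_left.2 fun y hya hyb => ?_)
  rcases (mem_compress_iff hℓa hia).1 hya with ⟨hya' | rfl, hyℓ⟩
  · exact hyℓ (hcommon y hya' hyb)
  · exact hib hyb

/-- The `(i,ℓ)`-shift of an intersecting family is intersecting. [folklore] -/
private theorem intersecting_compression {i ℓ : α} {𝒜 : Finset (Finset α)}
    (h𝒜 : (𝒜 : Set (Finset α)).Intersecting) :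
    ((𝓒 ({i} : Finset α) {ℓ} 𝒜 : Finset (Finset α)) : Set (Finset α)).Intersecting := by
  intro a ha b hb
  rcases mem_compression_cases ha with ha𝒜 | ⟨a₀, ha₀, ha₀ℓ, -, rfl⟩
  · rcases mem_compression_cases hb with hb𝒜 | ⟨b₀, hb₀, hb₀ℓ, -, rfl⟩
    · exact h𝒜 ha𝒜 hb𝒜
    · exact not_disjoint_compress h𝒜 ha𝒜 (compress_mem_of_mem_of_mem_compression ha ha𝒜) hb₀ hb₀ℓ.1 hb₀ℓ.2
  · rcases mem_compression_cases hb with hb𝒜 | ⟨b₀, hb₀, hb₀ℓ, -, rfl⟩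
    · exact fun h => not_disjoint_compress h𝒜 hb𝒜 (compress_mem_of_mem_of_mem_compression hb hb𝒜) ha₀ ha₀ℓ.1
        ha₀ℓ.2 h.symm
    · have hiℓ : i ≠ ℓ := fun h => ha₀ℓ.2 (h ▸ ha₀ℓ.1) -- both are shifts: both contain `i`
      exact fun h => disjoint_left.1 h ((mem_compress_iff ha₀ℓ.1 ha₀ℓ.2).2 ⟨Or.inr rfl, hiℓ⟩)
        ((mem_compress_iff hb₀ℓ.1 hb₀ℓ.2).2 ⟨Or.inr rfl, hiℓ⟩)

/-! ### Reaching a compressed family: the number of members containing `ℓ` decreases -/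

/-- A non-trivial `(i,ℓ)`-shift strictly decreases the number of members containing `ℓ`. [folklore] -/
private theorem card_filter_mem_compression_lt {i ℓ : α} {𝒜 : Finset (Finset α)}
    (h : 𝓒 ({i} : Finset α) {ℓ} 𝒜 ≠ 𝒜) :
    #((𝓒 ({i} : Finset α) {ℓ} 𝒜).filter fun a => ℓ ∈ a) < #(𝒜.filter fun a => ℓ ∈ a) := by
  -- some member of `𝒜` has its shift outside `𝒜`
  have hex : ∃ a ∈ 𝒜, UV.compress ({i} : Finset α) {ℓ} a ∉ 𝒜 := by
    by_contra hall
    push Not at hall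
    refine h (ext fun a => ?_)
    rw [UV.mem_compression]
    refine ⟨?_, fun ha => Or.inl ⟨ha, hall a ha⟩⟩
    rintro (⟨ha, -⟩ | ⟨-, b, hb, rfl⟩)
    · exact ha
    · exact hall b hb
  obtain ⟨a, ha, hca⟩ := hex
  have hℓa : ℓ ∈ a ∧ i ∉ a := by_contra fun hn => by rw [compress_eq_self hn] at hca; exact hca ha
  have hsub : ((𝓒 ({i} : Finset α) {ℓ} 𝒜).filter fun a => ℓ ∈ a) ⊆ 𝒜.filter fun a => ℓ ∈ a := by
    intro x hx
    rw [mem_filter] at hx ⊢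
    rcases mem_compression_cases hx.1 with hx𝒜 | ⟨b, -, hbℓ, -, rfl⟩
    · exact ⟨hx𝒜, hx.2⟩
    · exact (not_mem_compress hbℓ hx.2).elim
  refine card_lt_card ((ssubset_iff_of_subset hsub).2 ⟨a, mem_filter.2 ⟨ha, hℓa.1⟩, fun hmem => ?_⟩)
  rcases UV.mem_compression.1 (mem_filter.1 hmem).1 with ⟨-, hc⟩ | ⟨hna, -⟩
  · exact hca hc
  · exact hna ha

/-- Either the family is `({i},{ℓ})`-compressed for every `i ∈ s`, or some `i ∈ s` gives a non-trivial shift. [folklore] -/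
private theorem isCompressed_or_exists (s : Finset α) (ℓ : α) (𝒜 : Finset (Finset α)) :
    (∀ i ∈ s, UV.IsCompressed ({i} : Finset α) {ℓ} 𝒜) ∨
      ∃ i ∈ s, 𝓒 ({i} : Finset α) {ℓ} 𝒜 ≠ 𝒜 := by
  by_cases hall : ∀ i ∈ s, UV.IsCompressed ({i} : Finset α) {ℓ} 𝒜
  · exact Or.inl hall
  · push Not at hall; exact Or.inr hall

/-- From any `k`-uniform intersecting family inside `s` one reaches, by `(i,ℓ)`-shifts with `i ∈ s`, a family of the same
size inside `s`, `k`-uniform, intersecting, with no larger shadow, and `({i},{ℓ})`-compressed for every `i ∈ s`.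
(Induction on the number of members containing `ℓ`.) [folklore] -/
private theorem exists_compressed (s : Finset α) (ℓ : α) (k : ℕ) :
    ∀ (m : ℕ) (𝒜 : Finset (Finset α)), #(𝒜.filter fun a => ℓ ∈ a) ≤ m →
      (∀ a ∈ 𝒜, a ⊆ s) → (𝒜 : Set (Finset α)).Sized k → (𝒜 : Set (Finset α)).Intersecting →
      ∃ ℬ : Finset (Finset α), (∀ b ∈ ℬ, b ⊆ s) ∧ #ℬ = #𝒜 ∧ (ℬ : Set (Finset α)).Sized k ∧
        (ℬ : Set (Finset α)).Intersecting ∧ #(∂ ℬ) ≤ #(∂ 𝒜) ∧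
        ∀ i ∈ s, UV.IsCompressed ({i} : Finset α) {ℓ} ℬ := by
  intro m
  induction m with
  | zero =>
    intro 𝒜 hm hs hk hI
    rcases isCompressed_or_exists s ℓ 𝒜 with hall | ⟨i, -, hne⟩
    · exact ⟨𝒜, hs, rfl, hk, hI, le_rfl, hall⟩
    · exact absurd ((card_filter_mem_compression_lt hne).trans_le hm) (Nat.not_lt_zero _)
  | succ m ih =>
    intro 𝒜 hm hs hk hI
    rcases isCompressed_or_exists s ℓ 𝒜 with hall | ⟨i, hi, hne⟩
    · exact ⟨𝒜, hs, rfl, hk, hI, le_rfl, hall⟩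
    · have hlt := card_filter_mem_compression_lt hne
      obtain ⟨ℬ, hℬs, hℬcard, hℬk, hℬI, hℬsh, hℬc⟩ :=
        ih (𝓒 ({i} : Finset α) {ℓ} 𝒜) (by omega) (subset_of_mem_compression hi hs)
          (hk.uvCompression (by rw [card_singleton, card_singleton])) (intersecting_compression hI)
      refine ⟨ℬ, hℬs, hℬcard.trans (UV.card_compression _ _ _), hℬk, hℬI, hℬsh.trans ?_, hℬc⟩
      refine UV.card_shadow_compression_le _ _ fun x hx => ⟨ℓ, mem_singleton_self ℓ, ?_⟩
      rw [mem_singleton.1 hx, erase_singleton, erase_singleton]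
      exact UV.isCompressed_self _ _

/-! ### Splitting a compressed family along `ℓ` -/

/-- `#ℬ = #{B : ℓ ∉ B} + #{B ∖ {ℓ} : ℓ ∈ B}`. [folklore] -/
private theorem card_split (ℬ : Finset (Finset α)) (ℓ : α) :
    #ℬ = #(ℬ.filter fun b => ℓ ∉ b) + #((ℬ.filter fun b => ℓ ∈ b).image fun b => b.erase ℓ) := by
  rw [card_image_of_injOn, add_comm, card_filter_add_card_filter_not]
  intro b hb b' hb' h
  have h' : b.erase ℓ = b'.erase ℓ := h
  rw [← insert_erase (mem_filter.1 hb).2, h', insert_erase (mem_filter.1 hb').2]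

/-- `∂ℬ ⊇ ∂{B : ℓ ∉ B} ⊔ {E ∪ {ℓ} : E ∈ ∂{B ∖ {ℓ} : ℓ ∈ B}}`, as a cardinality inequality. [folklore] -/
private theorem card_shadow_split (ℬ : Finset (Finset α)) (ℓ : α) :
    #(∂ (ℬ.filter fun b => ℓ ∉ b)) + #(∂ ((ℬ.filter fun b => ℓ ∈ b).image fun b => b.erase ℓ)) ≤
      #(∂ ℬ) := by
  set ℬ₀ := ℬ.filter fun b => ℓ ∉ b with hℬ₀
  set ℬ₁ := (ℬ.filter fun b => ℓ ∈ b).image fun b => b.erase ℓ with hℬ₁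
  have h0 : ∂ ℬ₀ ⊆ ∂ ℬ := shadow_mono (filter_subset _ _)
  have hℓ0 : ∀ e ∈ ∂ ℬ₀, ℓ ∉ e := fun e he h => by
    obtain ⟨b, hb, hsub⟩ := exists_subset_of_mem_shadow he
    exact (mem_filter.1 hb).2 (hsub h)
  have hℓ1 : ∀ e ∈ ∂ ℬ₁, ℓ ∉ e := fun e he h => by
    obtain ⟨b, hb, hsub⟩ := exists_subset_of_mem_shadow he
    obtain ⟨c, -, rfl⟩ := mem_image.1 hb
    exact (notMem_erase ℓ c) (hsub h)
  have h1 : (∂ ℬ₁).image (insert ℓ) ⊆ ∂ ℬ := by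
    intro t ht
    obtain ⟨e, he, rfl⟩ := mem_image.1 ht
    rw [mem_shadow_iff] at he
    obtain ⟨b', hb', x, hx, rfl⟩ := he
    obtain ⟨b, hb, rfl⟩ := mem_image.1 hb'
    have : insert ℓ ((b.erase ℓ).erase x) = b.erase x := by
      rw [erase_right_comm, insert_erase (mem_erase.2 ⟨(mem_erase.1 hx).1.symm, (mem_filter.1 hb).2⟩)]
    rw [this]
    exact erase_mem_shadow (mem_filter.1 hb).1 (mem_erase.1 hx).2
  have hdisj : Disjoint (∂ ℬ₀) ((∂ ℬ₁).image (insert ℓ)) := disjoint_left.2 fun e he he' => by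
    obtain ⟨e', -, rfl⟩ := mem_image.1 he'
    exact hℓ0 _ he (mem_insert_self ℓ e')
  calc #(∂ ℬ₀) + #(∂ ℬ₁) = #(∂ ℬ₀) + #((∂ ℬ₁).image (insert ℓ)) := by
        rw [card_image_of_injOn]
        intro e he e' he' h
        have h' : insert ℓ e = insert ℓ e' := h
        rw [← erase_insert (hℓ1 e he), h', erase_insert (hℓ1 e' he')]
    _ = #(∂ ℬ₀ ∪ (∂ ℬ₁).image (insert ℓ)) := (card_union_of_disjoint hdisj).symm
    _ ≤ #(∂ ℬ) := card_le_card (union_subset h0 h1)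

/-- The crux of Katona's proof: if `ℬ` is `k`-uniform, intersecting, `({i},{ℓ})`-compressed for every `i` in a set `s`
with `2k ≤ #s`, then `{B ∖ {ℓ} : B ∈ ℬ, ℓ ∈ B}` is intersecting. [cite: Katona1964, Theorem 1] -/
private theorem intersecting_image_erase_of_isCompressed {s : Finset α} {ℓ : α} {k : ℕ}
    {ℬ : Finset (Finset α)} (hk : (ℬ : Set (Finset α)).Sized k)
    (hI : (ℬ : Set (Finset α)).Intersecting)
    (hc : ∀ i ∈ s, UV.IsCompressed ({i} : Finset α) {ℓ} ℬ) (h2k : 2 * k ≤ #s) :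
    ((((ℬ.filter fun b => ℓ ∈ b).image fun b => b.erase ℓ) : Finset (Finset α)) :
      Set (Finset α)).Intersecting := by
  intro a ha b hb hab
  obtain ⟨A, hA, rfl⟩ := mem_image.1 ha
  obtain ⟨B, hB, rfl⟩ := mem_image.1 hb
  obtain ⟨hAℬ, hAℓ⟩ := mem_filter.1 hA
  obtain ⟨hBℬ, hBℓ⟩ := mem_filter.1 hB
  have hcardU : #(A ∪ B) < #s := by -- `#(A ∪ B) = 2k - 1 < #s`
    have h1 : #(A ∪ B) + #(A ∩ B) = #A + #B := card_union_add_card_inter A B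
    have h2 : 0 < #(A ∩ B) := card_pos.2 ⟨ℓ, mem_inter.2 ⟨hAℓ, hBℓ⟩⟩
    rw [hk hAℬ, hk hBℬ] at h1
    omega
  have hex : ∃ i ∈ s, i ∉ A ∪ B := by -- pick `i ∈ s` outside `A ∪ B`
    by_contra h
    push Not at h
    exact absurd (card_le_card (show s ⊆ A ∪ B from fun i hi => h i hi)) (not_le.2 hcardU)
  obtain ⟨i, hi, hiAB⟩ := hex
  rw [mem_union, not_or] at hiAB
  have hB' : UV.compress ({i} : Finset α) {ℓ} B ∈ ℬ := by -- the shift of `B` is in `ℬ` ...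
    have := UV.compress_mem_compression (u := ({i} : Finset α)) (v := {ℓ}) hBℬ
    rwa [(hc i hi).eq] at this
  refine hI hAℬ hB' (disjoint_left.2 fun x hxA hxB' => ?_) -- ... and it is disjoint from `A`
  rcases (mem_compress_iff hBℓ hiAB.2).1 hxB' with ⟨hxB | rfl, hxℓ⟩
  · exact disjoint_left.1 hab (mem_erase.2 ⟨hxℓ, hxA⟩) (mem_erase.2 ⟨hxℓ, hxB⟩)
  · exact hiAB.1 hxA

/-! ### The local LYM inequality relative to a ground finset -/

/-- Local LYM inequality relative to a ground finset `s`: for a `k`-uniform family `𝒜 ⊆ 2^s`, `#𝒜 · k ≤ #∂𝒜 · (#s + 1 -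
k)` (each member has `k` shadows; each shadow set has at most `#s - (k - 1)` members above it). [folklore] -/
private theorem card_mul_le_card_shadow_mul {s : Finset α} {k : ℕ} {𝒜 : Finset (Finset α)}
    (hs : ∀ a ∈ 𝒜, a ⊆ s) (hk : (𝒜 : Set (Finset α)).Sized k) :
    #𝒜 * k ≤ #(∂ 𝒜) * (#s + 1 - k) := by
  refine card_mul_le_card_mul (fun a e => e ⊆ a) (fun a ha => ?_) (fun e he => ?_)
  · have hsub : a.image (fun x => a.erase x) ⊆ (∂ 𝒜).bipartiteAbove (fun a e => e ⊆ a) a := by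
      intro e he
      obtain ⟨x, hx, rfl⟩ := mem_image.1 he
      exact (mem_bipartiteAbove _).2 ⟨erase_mem_shadow ha hx, erase_subset x a⟩
    calc k = #a := (hk ha).symm
      _ = #(a.image fun x => a.erase x) := (card_image_of_injOn (erase_injOn a)).symm
      _ ≤ _ := card_le_card hsub
  · obtain ⟨a₀, ha₀, hea₀, hcard₀⟩ := mem_shadow_iff_exists_mem_card_add_one.1 he
    have hek : #e + 1 = k := by rw [← hcard₀, hk ha₀]
    have hes : e ⊆ s := hea₀.trans (hs a₀ ha₀)
    have hsub : 𝒜.bipartiteBelow (fun a e => e ⊆ a) e ⊆ (s \ e).image fun x => insert x e := by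
      intro a ha
      obtain ⟨ha𝒜, hea⟩ := (mem_bipartiteBelow _).1 ha
      have hcard : #(a \ e) = 1 := by rw [card_sdiff_of_subset hea, hk ha𝒜]; omega
      obtain ⟨x, hx⟩ := card_eq_one.1 hcard
      have hxmem : x ∈ a \ e := hx ▸ mem_singleton_self x
      refine mem_image.2 ⟨x, mem_sdiff.2 ⟨hs a ha𝒜 (mem_sdiff.1 hxmem).1, (mem_sdiff.1 hxmem).2⟩, ?_⟩
      rw [insert_eq, ← hx, sdiff_union_of_subset hea]
    calc #(𝒜.bipartiteBelow (fun a e => e ⊆ a) e) ≤ #((s \ e).image fun x => insert x e) := card_le_card hsub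
      _ ≤ #(s \ e) := card_image_le
      _ = #s - #e := card_sdiff_of_subset hes
      _ ≤ #s + 1 - k := by omega

/-! ### The induction -/

/-- Katona's theorem relative to a ground finset of size `n` (the induction statement). [cite: Katona1964, Theorem 1] -/
private theorem card_le_card_shadow_aux (n : ℕ) : ∀ (s : Finset α), #s = n →
    ∀ (k : ℕ) (𝒜 : Finset (Finset α)), (∀ a ∈ 𝒜, a ⊆ s) → (𝒜 : Set (Finset α)).Sized k →
      (𝒜 : Set (Finset α)).Intersecting → #𝒜 ≤ #(∂ 𝒜) := by
  induction n using Nat.strong_induction_on with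
  | _ n ih =>
  intro s hsn k 𝒜 hs hk hI
  rcases 𝒜.eq_empty_or_nonempty with rfl | hne
  · simp
  have hk1 : 1 ≤ k := by -- members are nonempty, so `1 ≤ k`
    obtain ⟨a, ha⟩ := hne
    rw [← hk ha, Nat.one_le_iff_ne_zero, Ne, card_eq_zero]
    exact fun h => hI ha ha (h ▸ disjoint_bot_left)
  by_cases h2k : #s + 1 ≤ 2 * k
  · -- few points: local LYM
    have h' : #𝒜 * k ≤ #(∂ 𝒜) * k := (card_mul_le_card_shadow_mul hs hk).trans (Nat.mul_le_mul_left _ (by omega))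
    exact Nat.le_of_mul_le_mul_right h' hk1
  · -- many points: shift, split along `ℓ`, induct
    have h2k' : 2 * k ≤ #s := by omega
    obtain ⟨ℓ, hℓ⟩ : s.Nonempty := card_pos.1 (by omega)
    obtain ⟨ℬ, hℬs, hℬcard, hℬk, hℬI, hℬsh, hℬc⟩ := exists_compressed s ℓ k _ 𝒜 le_rfl hs hk hI
    set ℬ₀ := ℬ.filter fun b => ℓ ∉ b with hℬ₀
    set ℬ₁ := (ℬ.filter fun b => ℓ ∈ b).image fun b => b.erase ℓ with hℬ₁
    have hlt : #(s.erase ℓ) < n := by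
      rw [card_erase_of_mem hℓ, hsn]
      have : 0 < n := hsn ▸ card_pos.2 ⟨ℓ, hℓ⟩
      omega
    have hℬ₀s : ∀ b ∈ ℬ₀, b ⊆ s.erase ℓ := fun b hb x hx =>
      mem_erase.2 ⟨fun h => (mem_filter.1 hb).2 (h ▸ hx), hℬs b (mem_filter.1 hb).1 hx⟩
    have hℬ₁s : ∀ b ∈ ℬ₁, b ⊆ s.erase ℓ := fun b hb x hx => by
      obtain ⟨c, hc, rfl⟩ := mem_image.1 hb
      exact mem_erase.2 ⟨(mem_erase.1 hx).1, hℬs c (mem_filter.1 hc).1 (mem_erase.1 hx).2⟩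
    have hℬ₀k : (ℬ₀ : Set (Finset α)).Sized k := fun b hb => hℬk (mem_filter.1 (show b ∈ ℬ₀ from hb)).1
    have hℬ₁k : (ℬ₁ : Set (Finset α)).Sized (k - 1) := by
      intro b hb
      obtain ⟨c, hc, rfl⟩ := mem_image.1 (show b ∈ ℬ₁ from hb)
      rw [card_erase_of_mem (mem_filter.1 hc).2, hℬk (mem_filter.1 hc).1]
    have hℬ₀I : (ℬ₀ : Set (Finset α)).Intersecting := hℬI.mono (coe_subset.2 (filter_subset _ _))
    have hℬ₁I : (ℬ₁ : Set (Finset α)).Intersecting := intersecting_image_erase_of_isCompressed hℬk hℬI hℬc h2k'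
    have h0 : #ℬ₀ ≤ #(∂ ℬ₀) := ih _ hlt (s.erase ℓ) rfl k ℬ₀ hℬ₀s hℬ₀k hℬ₀I
    have h1 : #ℬ₁ ≤ #(∂ ℬ₁) := ih _ hlt (s.erase ℓ) rfl (k - 1) ℬ₁ hℬ₁s hℬ₁k hℬ₁I
    calc #𝒜 = #ℬ := hℬcard.symm
      _ = #ℬ₀ + #ℬ₁ := card_split ℬ ℓ
      _ ≤ #(∂ ℬ₀) + #(∂ ℬ₁) := add_le_add h0 h1
      _ ≤ #(∂ ℬ) := card_shadow_split ℬ ℓ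
      _ ≤ #(∂ 𝒜) := hℬsh

end KatonaShadow

/-- **Katona's intersecting shadow theorem** (Katona 1964, Theorem 1 with `t = 1`, shadow one level down): if `𝒜` is a
finite family of `k`-element sets any two of which intersect, then `#𝒜 ≤ #∂𝒜`. Equality holds e.g. for all `k`-subsets
of a `(2k-1)`-set. [cite: Katona1964, Theorem 1] -/
theorem card_le_card_shadow_of_sized_of_intersecting {k : ℕ} {𝒜 : Finset (Finset α)}
    (hk : (𝒜 : Set (Finset α)).Sized k) (hI : (𝒜 : Set (Finset α)).Intersecting) :
    #𝒜 ≤ #(∂ 𝒜) :=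
  KatonaShadow.card_le_card_shadow_aux _ (𝒜.biUnion id) rfl k 𝒜
    (fun a ha => by simpa using subset_biUnion_of_mem id ha) hk hI

/-- **Non-uniform consequence**: every finite intersecting family `𝒜` (no two members disjoint; in particular `∅ ∉ 𝒜`)
satisfies `#𝒜 ≤ #∂𝒜` — apply Katona's theorem on each level `{A ∈ 𝒜 : #A = k}` and note that shadows of different
levels are disjoint sub-families of `∂𝒜`. [cite: Katona1964, Theorem 1] -/
theorem card_le_card_shadow_of_intersecting {𝒜 : Finset (Finset α)}
    (hI : (𝒜 : Set (Finset α)).Intersecting) : #𝒜 ≤ #(∂ 𝒜) := by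
  set K : Finset ℕ := 𝒜.image card with hK
  have hfib : #𝒜 = ∑ k ∈ K, #(𝒜.filter fun a => #a = k) :=
    card_eq_sum_card_fiberwise fun a ha => mem_image_of_mem _ ha
  have hsized : ∀ k, ((𝒜.filter fun a => #a = k : Finset (Finset α)) : Set (Finset α)).Sized k :=
    fun k a ha => (mem_filter.1 (show a ∈ 𝒜.filter fun a => #a = k from ha)).2
  have hle : ∀ k ∈ K, #(𝒜.filter fun a => #a = k) ≤ #(∂ (𝒜.filter fun a => #a = k)) :=
    fun k _ => card_le_card_shadow_of_sized_of_intersecting (hsized k)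
      (hI.mono (coe_subset.2 (filter_subset _ _)))
  have hpos : ∀ k ∈ K, 1 ≤ k := fun k hk => by
    obtain ⟨a, ha, rfl⟩ := mem_image.1 hk
    rw [Nat.one_le_iff_ne_zero, Ne, card_eq_zero]
    exact fun h => hI ha ha (h ▸ disjoint_bot_left)
  have hdisj : (K : Set ℕ).PairwiseDisjoint fun k => ∂ (𝒜.filter fun a => #a = k) := by
    intro k hk k' hk' hne
    rw [Function.onFun, disjoint_left]
    intro e he he'
    have h1 : #e = k - 1 := (hsized k).shadow he
    have h2 : #e = k' - 1 := (hsized k').shadow he'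
    have := hpos k hk; have := hpos k' hk'; omega
  calc #𝒜 = ∑ k ∈ K, #(𝒜.filter fun a => #a = k) := hfib
    _ ≤ ∑ k ∈ K, #(∂ (𝒜.filter fun a => #a = k)) := sum_le_sum hle
    _ = #(K.biUnion fun k => ∂ (𝒜.filter fun a => #a = k)) := (card_biUnion hdisj).symm
    _ ≤ #(∂ 𝒜) := card_le_card (biUnion_subset.2 fun k _ => shadow_mono (filter_subset _ _))

end Literature.Combinatorics.SetFamily
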